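import Mathlib
import Summits.CriticalPhenomena.PercolationContinuityZ3.Theses.PercExchangeRateTransport

/-!
# Birth skeleton — crux `TransportLemma` (stmt-CriticalPhenomena-16063)
Route `route-CriticalPhenomena-PercExchangeRateTransport`, sub-problem `PercolationContinuityZ3`.

The crux is the abstract (percolation-free) transport lemma: C¹ functions `Θ n` on the open unit
square, nondecreasing in `p` and `t`, nonincreasing in `n`, nonnegative, with `Θ∞ = ⨅ n, Θ n` having
a continuous threshold curve `pc` on `[lo,hi]`, a field `a` continuous on the two-sided `ρ`-collar and
`L`-Lipschitz in `p` on its right half, and the exchange-rate inequality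
`|∂ₜΘ n − a ∂ₚΘ n| ≤ η ∂ₚΘ n` (n ≥ m(η)) on `{pc t − δ(η) ≤ p ≤ pc t + ρ}` ⇒ `t ↦ Θ∞ (pc t) t` is
constant on `[lo,hi]`.

Line (card exchange-rate-transport; route dossier "Proof = pinching + Euler polygons + discrete
Grönwall + right-continuity"):

* `stub_curveIsCharacteristic` — PINCHING. Straight test segments of slope `−(a(pc t₀,t₀) ∓ 2η)`
  issued from `(pc t₀ ± ε, t₀)` are monotone for every `Θ n`, `n ≥ m(η)` (chain rule + exchange
  inequality + uniform continuity of `a` on the compact collar), so by the threshold property they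
  fence the curve from above and from below; letting `ε → 0` gives
  `|pc t − pc t₀ + a(pc t₀,t₀)(t − t₀)| ≤ 2η|t − t₀|` locally uniformly: the threshold curve is a
  characteristic of the limiting field, `pc' = −a ∘ (pc, id)` on `[lo,hi]` (one-sided at the ends).
  Uses the TWO-SIDED `δ(η)`-strip but NOT the Lipschitz constant `L` and NOT monotonicity in `t`.
* `stub_levelTransport` — EULER POLYGONS + DISCRETE GRÖNWALL on the supercritical collar only.
  Given the characteristic property of `pc`, forward polygons of slopes `−(a(vertex) + 2η)` from
  `(pc t₀ + ε, t₀)` (resp. backward polygons of slopes `−(a(vertex) − 2η)` from `(pc t₁ + ε, t₁)`)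
  carry every `Θ n`, `n ≥ m(η)`, monotonically and stay above the curve by the discrete Grönwall
  inequality `D_{k+1} ≥ (1 − L h) D_k − (2η + o(1)) h` (this is where `L`-Lipschitz in `p` on the
  RIGHT half is spent); taking `⨅ n` gives the two level inequalities at every small `ε > 0`.
  Uses only the right closed collar: no threshold property, no `δ`-strip, no monotonicity in `t`.
* `rightContinuity` (PROVED here, not a stub) — the price paid by upper semicontinuity:
  `q ↦ ⨅ n, Θ n q t` is right-continuous at interior points (infimum of continuous nondecreasing
  functions).
* `TransportLemma_of_stubs` — assembly (PROVED, no sorry): pinching feeds the transport stub; the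
  level inequalities at `ε ↓ 0` and right-continuity at `(pc t, t)` and `(pc hi, hi)` give
  `J t ≤ J hi ≤ J t`; `TransportLemma_of : TransportLemma := TransportLemma_of_stubs stub₁ stub₂`
  concludes the crux BY NAME (sorries only inside the two `stub_*`).

Disproof used: none relevant (no `Disproof.lean` / Negative lemmas exist for this crux at
registration time, `ledger crux ls stmt-CriticalPhenomena-16063` = no workfiles).
-/

namespace Summit.CriticalPhenomena.PercolationContinuityZ3.Cruxes.TransportLemma.Birth

open Filter Topology Set

/-- **Stub 1 — pinching: the threshold curve is a characteristic of the limiting exchange-rate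
field.** Under the hypotheses of the transport lemma except the Lipschitz clause and monotonicity
in `t` (not needed here), `pc` is differentiable within `[lo,hi]` at every point, with derivative
`−a (pc t) t`. Size: M (fencing by straight test segments + threshold property + uniform continuity
of `a` and `pc`; one page). -/
theorem stub_curveIsCharacteristic :
    ∀ (Θ : ℕ → ℝ → ℝ → ℝ) (pc : ℝ → ℝ) (a : ℝ → ℝ → ℝ) (lo hi ρ : ℝ),
      0 < lo → lo < hi → hi < 1 → 0 < ρ →
      (∀ n, ContDiffOn ℝ 1 (fun x : ℝ × ℝ => Θ n x.1 x.2) (Set.Ioo 0 1 ×ˢ Set.Ioo 0 1)) →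
      (∀ n t, Monotone (fun p => Θ n p t)) →
      (∀ p t, Antitone (fun n => Θ n p t)) →
      (∀ n p t, 0 ≤ Θ n p t) →
      ContinuousOn pc (Set.Icc lo hi) →
      (∀ t ∈ Set.Icc lo hi, ρ < pc t ∧ pc t + ρ < 1) →
      (∀ t ∈ Set.Icc lo hi, ∀ p : ℝ,
          (p < pc t → (⨅ n, Θ n p t) = 0) ∧ (pc t < p → 0 < ⨅ n, Θ n p t)) →
      ContinuousOn (fun x : ℝ × ℝ => a x.1 x.2)
          {x : ℝ × ℝ | x.2 ∈ Set.Icc lo hi ∧ |x.1 - pc x.2| ≤ ρ} →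
      (∀ η > (0 : ℝ), ∃ δ > (0 : ℝ), ∃ m : ℕ, ∀ n ≥ m, ∀ t ∈ Set.Icc lo hi, ∀ p : ℝ,
          pc t - δ ≤ p → p ≤ pc t + ρ →
          |deriv (fun s => Θ n p s) t - a p t * deriv (fun q => Θ n q t) p|
            ≤ η * deriv (fun q => Θ n q t) p) →
      ∀ t ∈ Set.Icc lo hi, HasDerivWithinAt pc (-(a (pc t) t)) (Set.Icc lo hi) t := by
  sorry

/-- **Stub 2 — level transport along Euler polygons (discrete Grönwall on the supercritical
collar).** If, in addition to regularity/monotonicity of the `Θ n`, continuity and `L`-Lipschitz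
continuity in `p` of `a` on the RIGHT closed collar and the exchange-rate inequality there, the
curve `pc` is a characteristic (`pc' = −a (pc t) t` within `[lo,hi]`), then for `lo ≤ t₀ ≤ t₁ ≤ hi`
and every small `ε > 0`:
`Θ∞ (pc t₁) t₁ ≤ Θ∞ (pc t₀ + ε) t₀` and `Θ∞ (pc t₀) t₀ ≤ Θ∞ (pc t₁ + ε) t₁` (`Θ∞ = ⨅ n, Θ n`).
Size: M–L (polygon construction with mesh from uniform continuity of `a`, chain rule on each
segment, discrete Grönwall to stay inside the right collar and above the curve; two pages). -/
theorem stub_levelTransport :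
    ∀ (Θ : ℕ → ℝ → ℝ → ℝ) (pc : ℝ → ℝ) (a : ℝ → ℝ → ℝ) (lo hi ρ L : ℝ),
      0 < lo → lo < hi → hi < 1 → 0 < ρ →
      (∀ n, ContDiffOn ℝ 1 (fun x : ℝ × ℝ => Θ n x.1 x.2) (Set.Ioo 0 1 ×ˢ Set.Ioo 0 1)) →
      (∀ n t, Monotone (fun p => Θ n p t)) →
      (∀ p t, Antitone (fun n => Θ n p t)) →
      (∀ n p t, 0 ≤ Θ n p t) →
      ContinuousOn pc (Set.Icc lo hi) →
      (∀ t ∈ Set.Icc lo hi, ρ < pc t ∧ pc t + ρ < 1) →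
      ContinuousOn (fun x : ℝ × ℝ => a x.1 x.2)
          {x : ℝ × ℝ | x.2 ∈ Set.Icc lo hi ∧ pc x.2 ≤ x.1 ∧ x.1 ≤ pc x.2 + ρ} →
      (∀ t ∈ Set.Icc lo hi, ∀ p q : ℝ, pc t ≤ p → p ≤ pc t + ρ → pc t ≤ q → q ≤ pc t + ρ →
          |a p t - a q t| ≤ L * |p - q|) →
      (∀ η > (0 : ℝ), ∃ m : ℕ, ∀ n ≥ m, ∀ t ∈ Set.Icc lo hi, ∀ p : ℝ,
          pc t ≤ p → p ≤ pc t + ρ →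
          |deriv (fun s => Θ n p s) t - a p t * deriv (fun q => Θ n q t) p|
            ≤ η * deriv (fun q => Θ n q t) p) →
      (∀ t ∈ Set.Icc lo hi, HasDerivWithinAt pc (-(a (pc t) t)) (Set.Icc lo hi) t) →
      ∀ t₀ t₁ : ℝ, lo ≤ t₀ → t₀ ≤ t₁ → t₁ ≤ hi →
        ∃ ε₀ > (0 : ℝ), ∀ ε : ℝ, 0 < ε → ε < ε₀ →
          (⨅ n, Θ n (pc t₁) t₁) ≤ (⨅ n, Θ n (pc t₀ + ε) t₀) ∧
          (⨅ n, Θ n (pc t₀) t₀) ≤ (⨅ n, Θ n (pc t₁ + ε) t₁) := by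
  sorry

/-- Right-continuity of the infimum level function `q ↦ ⨅ n, Θ n q t` at interior points: an
infimum of continuous nondecreasing functions is upper semicontinuous and nondecreasing, hence
right-continuous. (Proved; this is the "price paid by upper semicontinuity" in the route.) -/
theorem rightContinuity (Θ : ℕ → ℝ → ℝ → ℝ) (t : ℝ)
    (hcont : ∀ n, ContinuousOn (fun x : ℝ × ℝ => Θ n x.1 x.2) (Set.Ioo 0 1 ×ˢ Set.Ioo 0 1))
    (hmp : ∀ n t, Monotone (fun p => Θ n p t))
    (hnn : ∀ n p t, 0 ≤ Θ n p t)
    (ht : t ∈ Set.Ioo (0 : ℝ) 1) :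
    ∀ p ∈ Set.Ioo (0 : ℝ) 1,
      Tendsto (fun q => ⨅ n, Θ n q t) (𝓝[>] p) (𝓝 (⨅ n, Θ n p t)) := by
  intro p hp
  have bdd : ∀ q : ℝ, BddBelow (Set.range fun n => Θ n q t) := fun q =>
    ⟨0, by rintro _ ⟨n, rfl⟩; exact hnn n q t⟩
  have hmonoF : ∀ q r : ℝ, q ≤ r → (⨅ n, Θ n q t) ≤ ⨅ n, Θ n r t := fun q r hqr =>
    ciInf_mono (bdd q) fun n => hmp n t hqr
  rw [tendsto_order]
  refine ⟨fun b hb => ?_, fun b hb => ?_⟩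
  · exact Filter.eventually_of_mem self_mem_nhdsWithin fun q hq =>
      lt_of_lt_of_le hb (hmonoF p q (le_of_lt hq))
  · obtain ⟨n₀, hn₀⟩ := exists_lt_of_ciInf_lt hb
    have hc : ContinuousAt (fun x : ℝ × ℝ => Θ n₀ x.1 x.2) (p, t) :=
      (hcont n₀).continuousAt (IsOpen.mem_nhds (isOpen_Ioo.prod isOpen_Ioo) ⟨hp, ht⟩)
    have hc' : ContinuousAt (fun q : ℝ => Θ n₀ q t) p :=
      ContinuousAt.comp (g := fun x : ℝ × ℝ => Θ n₀ x.1 x.2) (f := fun q : ℝ => (q, t)) hc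
        (by fun_prop : Continuous fun q : ℝ => (q, t)).continuousAt
    have hev : ∀ᶠ q in 𝓝 p, Θ n₀ q t < b := (tendsto_order.1 hc'.tendsto).2 b hn₀
    have hev' : ∀ᶠ q in 𝓝[>] p, Θ n₀ q t < b := hev.filter_mono nhdsWithin_le_nhds
    exact hev'.mono fun q hq => lt_of_le_of_lt (ciInf_le (bdd q) n₀) hq

/-- **Assembly, step 1 (proved, no `sorry`).** The two stub STATEMENTS imply the crux statement —
verbatim the body of `Summit.CriticalPhenomena.PercolationContinuityZ3.Theses.PercExchangeRateTransport.TransportLemma`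
(stated unfolded so that the registrar theorem `TransportLemma_of` below is the unique declaration of
this file concluding the crux by name). -/
theorem TransportLemma_of_stubs
    (hPinch : ∀ (Θ : ℕ → ℝ → ℝ → ℝ) (pc : ℝ → ℝ) (a : ℝ → ℝ → ℝ) (lo hi ρ : ℝ),
      0 < lo → lo < hi → hi < 1 → 0 < ρ →
      (∀ n, ContDiffOn ℝ 1 (fun x : ℝ × ℝ => Θ n x.1 x.2) (Set.Ioo 0 1 ×ˢ Set.Ioo 0 1)) →
      (∀ n t, Monotone (fun p => Θ n p t)) →
      (∀ p t, Antitone (fun n => Θ n p t)) →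
      (∀ n p t, 0 ≤ Θ n p t) →
      ContinuousOn pc (Set.Icc lo hi) →
      (∀ t ∈ Set.Icc lo hi, ρ < pc t ∧ pc t + ρ < 1) →
      (∀ t ∈ Set.Icc lo hi, ∀ p : ℝ,
          (p < pc t → (⨅ n, Θ n p t) = 0) ∧ (pc t < p → 0 < ⨅ n, Θ n p t)) →
      ContinuousOn (fun x : ℝ × ℝ => a x.1 x.2)
          {x : ℝ × ℝ | x.2 ∈ Set.Icc lo hi ∧ |x.1 - pc x.2| ≤ ρ} →
      (∀ η > (0 : ℝ), ∃ δ > (0 : ℝ), ∃ m : ℕ, ∀ n ≥ m, ∀ t ∈ Set.Icc lo hi, ∀ p : ℝ,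
          pc t - δ ≤ p → p ≤ pc t + ρ →
          |deriv (fun s => Θ n p s) t - a p t * deriv (fun q => Θ n q t) p|
            ≤ η * deriv (fun q => Θ n q t) p) →
      ∀ t ∈ Set.Icc lo hi, HasDerivWithinAt pc (-(a (pc t) t)) (Set.Icc lo hi) t)
    (hTrans : ∀ (Θ : ℕ → ℝ → ℝ → ℝ) (pc : ℝ → ℝ) (a : ℝ → ℝ → ℝ) (lo hi ρ L : ℝ),
      0 < lo → lo < hi → hi < 1 → 0 < ρ →
      (∀ n, ContDiffOn ℝ 1 (fun x : ℝ × ℝ => Θ n x.1 x.2) (Set.Ioo 0 1 ×ˢ Set.Ioo 0 1)) →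
      (∀ n t, Monotone (fun p => Θ n p t)) →
      (∀ p t, Antitone (fun n => Θ n p t)) →
      (∀ n p t, 0 ≤ Θ n p t) →
      ContinuousOn pc (Set.Icc lo hi) →
      (∀ t ∈ Set.Icc lo hi, ρ < pc t ∧ pc t + ρ < 1) →
      ContinuousOn (fun x : ℝ × ℝ => a x.1 x.2)
          {x : ℝ × ℝ | x.2 ∈ Set.Icc lo hi ∧ pc x.2 ≤ x.1 ∧ x.1 ≤ pc x.2 + ρ} →
      (∀ t ∈ Set.Icc lo hi, ∀ p q : ℝ, pc t ≤ p → p ≤ pc t + ρ → pc t ≤ q → q ≤ pc t + ρ →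
          |a p t - a q t| ≤ L * |p - q|) →
      (∀ η > (0 : ℝ), ∃ m : ℕ, ∀ n ≥ m, ∀ t ∈ Set.Icc lo hi, ∀ p : ℝ,
          pc t ≤ p → p ≤ pc t + ρ →
          |deriv (fun s => Θ n p s) t - a p t * deriv (fun q => Θ n q t) p|
            ≤ η * deriv (fun q => Θ n q t) p) →
      (∀ t ∈ Set.Icc lo hi, HasDerivWithinAt pc (-(a (pc t) t)) (Set.Icc lo hi) t) →
      ∀ t₀ t₁ : ℝ, lo ≤ t₀ → t₀ ≤ t₁ → t₁ ≤ hi →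
        ∃ ε₀ > (0 : ℝ), ∀ ε : ℝ, 0 < ε → ε < ε₀ →
          (⨅ n, Θ n (pc t₁) t₁) ≤ (⨅ n, Θ n (pc t₀ + ε) t₀) ∧
          (⨅ n, Θ n (pc t₀) t₀) ≤ (⨅ n, Θ n (pc t₁ + ε) t₁)) :
    ∀ (Θ : ℕ → ℝ → ℝ → ℝ) (pc : ℝ → ℝ) (a : ℝ → ℝ → ℝ) (lo hi ρ L : ℝ), 0 < lo → lo < hi → hi < 1 →
      0 < ρ → (∀ n, ContDiffOn ℝ 1 (fun x : ℝ × ℝ => Θ n x.1 x.2) (Set.Ioo 0 1 ×ˢ Set.Ioo 0 1)) →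
      (∀ n t, Monotone (fun p => Θ n p t)) → (∀ n p, Monotone (fun t => Θ n p t)) →
      (∀ p t, Antitone (fun n => Θ n p t)) → (∀ n p t, 0 ≤ Θ n p t) →
      ContinuousOn pc (Set.Icc lo hi) → (∀ t ∈ Set.Icc lo hi, ρ < pc t ∧ pc t + ρ < 1) →
      (∀ t ∈ Set.Icc lo hi, ∀ p : ℝ,
          (p < pc t → (⨅ n, Θ n p t) = 0) ∧ (pc t < p → 0 < ⨅ n, Θ n p t)) →
      ContinuousOn (fun x : ℝ × ℝ => a x.1 x.2)
          {x : ℝ × ℝ | x.2 ∈ Set.Icc lo hi ∧ |x.1 - pc x.2| ≤ ρ} →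
      (∀ t ∈ Set.Icc lo hi, ∀ p q : ℝ, pc t ≤ p → p ≤ pc t + ρ → pc t ≤ q → q ≤ pc t + ρ →
          |a p t - a q t| ≤ L * |p - q|) →
      (∀ η > (0 : ℝ), ∃ δ > (0 : ℝ), ∃ m : ℕ, ∀ n ≥ m, ∀ t ∈ Set.Icc lo hi, ∀ p : ℝ,
          pc t - δ ≤ p → p ≤ pc t + ρ →
          |deriv (fun s => Θ n p s) t - a p t * deriv (fun q => Θ n q t) p|
            ≤ η * deriv (fun q => Θ n q t) p) →
      ∀ t ∈ Set.Icc lo hi, (⨅ n, Θ n (pc t) t) = ⨅ n, Θ n (pc hi) hi := by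
  intro Θ pc a lo hi ρ L hlo hlohi hhi hρ hC1 hmp hmt hanti hnn hpc hcollar hthr ha hL hex t ht
  -- (1) pinching: the curve is a characteristic of the field `a`
  have hchar : ∀ s ∈ Set.Icc lo hi, HasDerivWithinAt pc (-(a (pc s) s)) (Set.Icc lo hi) s :=
    hPinch Θ pc a lo hi ρ hlo hlohi hhi hρ hC1 hmp hanti hnn hpc hcollar hthr ha hex
  -- (2) the transport step only needs the right closed collar
  have ha' : ContinuousOn (fun x : ℝ × ℝ => a x.1 x.2)
      {x : ℝ × ℝ | x.2 ∈ Set.Icc lo hi ∧ pc x.2 ≤ x.1 ∧ x.1 ≤ pc x.2 + ρ} := by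
    refine ha.mono ?_
    rintro ⟨q, s⟩ ⟨hs, h1, h2⟩
    refine ⟨hs, ?_⟩
    rw [abs_le]
    constructor <;> linarith
  have hex' : ∀ η > (0 : ℝ), ∃ m : ℕ, ∀ n ≥ m, ∀ s ∈ Set.Icc lo hi, ∀ p : ℝ,
      pc s ≤ p → p ≤ pc s + ρ →
      |deriv (fun r => Θ n p r) s - a p s * deriv (fun q => Θ n q s) p|
        ≤ η * deriv (fun q => Θ n q s) p := by
    intro η hη
    obtain ⟨δ, hδ, m, hm⟩ := hex η hη
    exact ⟨m, fun n hn s hs p h1 h2 => hm n hn s hs p (by linarith) h2⟩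
  have hTr := hTrans Θ pc a lo hi ρ L hlo hlohi hhi hρ hC1 hmp hanti hnn hpc hcollar ha' hL hex' hchar
  -- (3) right-continuity of the level function at the curve
  have hcont : ∀ n, ContinuousOn (fun x : ℝ × ℝ => Θ n x.1 x.2) (Set.Ioo 0 1 ×ˢ Set.Ioo 0 1) :=
    fun n => (hC1 n).continuousOn
  have hR : ∀ s ∈ Set.Icc lo hi,
      Tendsto (fun q => ⨅ n, Θ n q s) (𝓝[>] (pc s)) (𝓝 (⨅ n, Θ n (pc s) s)) := by
    intro s hs
    have hs' : s ∈ Set.Ioo (0 : ℝ) 1 := ⟨by linarith [hs.1], by linarith [hs.2]⟩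
    have hpcs : pc s ∈ Set.Ioo (0 : ℝ) 1 := by
      obtain ⟨h1, h2⟩ := hcollar s hs
      exact ⟨by linarith, by linarith⟩
    exact rightContinuity Θ s hcont hmp hnn hs' (pc s) hpcs
  -- (4) compare the levels at `t` and at `hi`
  have hhi' : hi ∈ Set.Icc lo hi := ⟨hlohi.le, le_rfl⟩
  obtain ⟨ε₀, hε₀, hε⟩ := hTr t hi ht.1 ht.2 le_rfl
  apply le_antisymm
  · -- J t ≤ J hi, by letting q ↓ pc hi in J t ≤ Θ∞ q hi
    refine ge_of_tendsto (hR hi hhi') ?_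
    refine Filter.eventually_of_mem (Ioo_mem_nhdsGT (show pc hi < pc hi + ε₀ by linarith)) ?_
    intro q hq
    have h := (hε (q - pc hi) (by linarith [hq.1]) (by linarith [hq.2])).2
    have e : pc hi + (q - pc hi) = q := by ring
    rw [e] at h
    exact h
  · -- J hi ≤ J t, by letting q ↓ pc t in J hi ≤ Θ∞ q t
    refine ge_of_tendsto (hR t ht) ?_
    refine Filter.eventually_of_mem (Ioo_mem_nhdsGT (show pc t < pc t + ε₀ by linarith)) ?_
    intro q hq
    have h := (hε (q - pc t) (by linarith [hq.1]) (by linarith [hq.2])).1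
    have e : pc t + (q - pc t) = q := by ring
    rw [e] at h
    exact h

/-- **THE SKELETON THEOREM (registrar shape).** The crux
`Summit.CriticalPhenomena.PercolationContinuityZ3.Theses.PercExchangeRateTransport.TransportLemma`,
concluded BY NAME from the two declared stubs through the sorry-free assembly
`TransportLemma_of_stubs` (the body of the `def` is matched by unfolding); the only `sorry`s in its
closure are `stub_curveIsCharacteristic` and `stub_levelTransport`. -/
theorem TransportLemma_of :
    Summit.CriticalPhenomena.PercolationContinuityZ3.Theses.PercExchangeRateTransport.TransportLemma :=
  TransportLemma_of_stubs stub_curveIsCharacteristic stub_levelTransport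

end Summit.CriticalPhenomena.PercolationContinuityZ3.Cruxes.TransportLemma.Birth
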